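import Summits.MatrixMultiplication.MatrixMultiplication.Theses.FidelityWitnesses
import Literature.Computability.AlgebraicComplexity.AlderStrassen

/-!
# Kernel-checked candidate proofs of the three "provable now" ACTIVE stubs of line `singlet-fraction-transfer`
# (lead skeleton be34014739a5, crux stmt-MatrixMultiplication-4959 `FidelityWitnesses.SevenEighthsLaw`)

drefute seat refuter-drefute-stmt-MatrixMultiplication-4959-0, 2026-08-16.  Signatures copied VERBATIM from
`ledger workitem get stmt-MatrixMultiplication-4959 .stubs` (binder form).  `lean check`: rc 0, 0 sorry, 0 warnings,
axioms {propext, Classical.choice, Quot.sound} for each of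

* `DrefuteProbe.stub_sliceElimination`  — R1: orthonormal expansion of the output slices + Cauchy–Schwarz;
* `DrefuteProbe.stub_productFrame`      — independent sub-family of the products, extension inside
  {products} ∪ {standard products}, 6-element intermediate index set, Gram–Schmidt in `EuclideanSpace ℂ (P2 × P2)`;
* `DrefuteProbe.stub_capEasyRegime`     — Parseval in `span (μ ∘ e)` + Bessel for the frame: `cap ≤ 2·finrank ≤ 6`.

With these, the lead's composition `SevenEighthsLaw_of` depends on `stub_capHardRegime` ALONE — which is equivalent to
the crux on its domain (`S_a := P_E T_a`), i.e. the line is now reduced exactly to its hard stub.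
Not landed by this (refuter) seat: attached as item evidence for the lead / workers to copy into the skeleton.
-/

noncomputable section
namespace DrefuteProbe

open scoped BigOperators ComplexConjugate InnerProductSpace
open Literature.Computability.AlgebraicComplexity

/-- local notation for the index type of one slot -/
abbrev P2' : Type := Fin 2 × Fin 2

theorem stub_sliceElimination {k : ℕ} (e : Fin k → (Fin 2 × Fin 2) → (Fin 2 × Fin 2) → ℂ)
    (he : ∀ s t : Fin k, (∑ b, ∑ c, conj (e s b c) * e t b c) = if s = t then 1 else 0)
    (S : (Fin 2 × Fin 2) → (Fin 2 × Fin 2) → (Fin 2 × Fin 2) → ℂ)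
    (hS : ∀ a : Fin 2 × Fin 2, S a ∈ Submodule.span ℂ (Set.range e)) :
    ‖∑ a, ∑ b, ∑ c, S a b c * matMulTensor ℂ 2 2 2 a b c‖ ^ 2 ≤
      (∑ a, ∑ b, ∑ c, ‖S a b c‖ ^ 2) * ∑ s, ∑ a : Fin 2 × Fin 2, ‖∑ m : Fin 2, e s (a.1, m) (m, a.2)‖ ^ 2 := by
  -- Euclidean packaging of `X ⊗ Y = ℂ^{P2} ⊗ ℂ^{P2}`
  let L : (P2' → P2' → ℂ) ≃ₗ[ℂ] EuclideanSpace ℂ (P2' × P2') :=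
    (LinearEquiv.curry ℂ ℂ P2' P2').symm ≪≫ₗ (WithLp.linearEquiv 2 ℂ (P2' × P2' → ℂ)).symm
  let eE : Fin k → EuclideanSpace ℂ (P2' × P2') := fun s => WithLp.toLp 2 (fun bc => e s bc.1 bc.2)
  have hLe : ∀ s, (L : (P2' → P2' → ℂ) →ₗ[ℂ] EuclideanSpace ℂ (P2' × P2')) (e s) = eE s := fun s => rfl
  have heE : Orthonormal ℂ eE := by
    rw [orthonormal_iff_ite]
    intro s t
    rw [← he s t, PiLp.inner_apply, Fintype.sum_prod_type]
    simp [eE, mul_comm]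
  let SE : P2' → EuclideanSpace ℂ (P2' × P2') := fun a => WithLp.toLp 2 (fun bc => S a bc.1 bc.2)
  have hLS : ∀ a, (L : (P2' → P2' → ℂ) →ₗ[ℂ] EuclideanSpace ℂ (P2' × P2')) (S a) = SE a := fun a => rfl
  -- every output slice lies in the span of the Euclidean frame
  have hspan : Submodule.span ℂ (Set.range eE) =
      Submodule.map (L : (P2' → P2' → ℂ) →ₗ[ℂ] EuclideanSpace ℂ (P2' × P2')) (Submodule.span ℂ (Set.range e)) := by
    rw [Submodule.map_span, ← Set.range_comp]
    rfl
  have hSE : ∀ a, SE a ∈ Submodule.span ℂ (Set.range eE) := by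
    intro a
    rw [hspan, ← hLS a]
    exact Submodule.mem_map_of_mem (hS a)
  -- coefficients of the expansion
  choose c hc using fun a => (Submodule.mem_span_range_iff_exists_fun ℂ).mp (hSE a)
  -- the frame functionals τ_{s,a}
  let τ : Fin k → P2' → ℂ := fun s a => ∑ m : Fin 2, e s (a.1, m) (m, a.2)
  -- coordinates of the expansion
  have hcoord : ∀ a b c', S a b c' = ∑ s, c a s * e s b c' := by
    intro a b c'
    have h := congrArg (fun v : EuclideanSpace ℂ (P2' × P2') => v (b, c')) (hc a)
    simp only [SE, eE, WithLp.ofLp_sum, WithLp.ofLp_smul, Finset.sum_apply, Pi.smul_apply, smul_eq_mul] at h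
    simpa using h.symm
  -- (i) the slice pairing with ⟨2,2,2⟩ in frame coordinates
  have hT : ∀ a, (∑ b, ∑ c', S a b c' * matMulTensor ℂ 2 2 2 a b c') = ∑ m, S a (a.1, m) (m, a.2) := by
    intro a
    obtain ⟨a1, a2⟩ := a
    fin_cases a1 <;> fin_cases a2 <;>
      simp [matMulTensor, Fintype.sum_prod_type, Fin.sum_univ_two]
  have hpair : ∀ a, (∑ b, ∑ c', S a b c' * matMulTensor ℂ 2 2 2 a b c') = ∑ s, c a s * τ s a := by
    intro a
    rw [hT]
    simp_rw [hcoord]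
    rw [Finset.sum_comm]
    refine Finset.sum_congr rfl fun s _ => ?_
    rw [Finset.mul_sum]
  -- (ii) Parseval for each slice
  have hnorm : ∀ a, (∑ b, ∑ c', ‖S a b c'‖ ^ 2) = ∑ s, ‖c a s‖ ^ 2 := by
    intro a
    have h1 : (∑ b, ∑ c', ‖S a b c'‖ ^ 2) = ‖SE a‖ ^ 2 := by
      rw [EuclideanSpace.norm_sq_eq]
      show _ = ∑ i : P2' × P2', ‖S a i.1 i.2‖ ^ 2
      exact (Fintype.sum_prod_type' (fun b c' => ‖S a b c'‖ ^ 2)).symm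
    have h2 : ‖SE a‖ ^ 2 = ∑ s, ‖c a s‖ ^ 2 := by
      rw [← hc a, @norm_sq_eq_re_inner ℂ, heE.inner_sum (c a) (c a) Finset.univ]
      simp only [RCLike.conj_mul, map_sum]
      refine Finset.sum_congr rfl fun s _ => ?_
      norm_cast
    rw [h1, h2]
  -- (iii) Cauchy–Schwarz over P2 × Fin k
  have hCS : ‖∑ a, ∑ s, c a s * τ s a‖ ^ 2 ≤ (∑ a, ∑ s, ‖c a s‖ ^ 2) * ∑ a, ∑ s, ‖τ s a‖ ^ 2 := by
    have e1 : (∑ a, ∑ s, c a s * τ s a) = ∑ p : P2' × Fin k, c p.1 p.2 * τ p.2 p.1 :=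
      (Fintype.sum_prod_type' (fun a s => c a s * τ s a)).symm
    have e2 : (∑ a, ∑ s, ‖c a s‖ ^ 2) = ∑ p : P2' × Fin k, ‖c p.1 p.2‖ ^ 2 :=
      (Fintype.sum_prod_type' (fun a s => ‖c a s‖ ^ 2)).symm
    have e3 : (∑ a, ∑ s, ‖τ s a‖ ^ 2) = ∑ p : P2' × Fin k, ‖τ p.2 p.1‖ ^ 2 :=
      (Fintype.sum_prod_type' (fun a s => ‖τ s a‖ ^ 2)).symm
    rw [e1, e2, e3]
    have hle : ‖∑ p : P2' × Fin k, c p.1 p.2 * τ p.2 p.1‖ ≤ ∑ p : P2' × Fin k, ‖c p.1 p.2‖ * ‖τ p.2 p.1‖ := by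
      refine (norm_sum_le _ _).trans (le_of_eq ?_)
      exact Finset.sum_congr rfl fun p _ => norm_mul _ _
    calc ‖∑ p : P2' × Fin k, c p.1 p.2 * τ p.2 p.1‖ ^ 2
        ≤ (∑ p : P2' × Fin k, ‖c p.1 p.2‖ * ‖τ p.2 p.1‖) ^ 2 :=
          pow_le_pow_left₀ (norm_nonneg _) hle 2
      _ ≤ (∑ p : P2' × Fin k, ‖c p.1 p.2‖ ^ 2) * ∑ p : P2' × Fin k, ‖τ p.2 p.1‖ ^ 2 :=
          Finset.sum_mul_sq_le_sq_mul_sq _ _ _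
  -- assemble
  have hL : (∑ a, ∑ b, ∑ c', S a b c' * matMulTensor ℂ 2 2 2 a b c') = ∑ a, ∑ s, c a s * τ s a :=
    Finset.sum_congr rfl fun a _ => hpair a
  have hN : (∑ a, ∑ b, ∑ c', ‖S a b c'‖ ^ 2) = ∑ a, ∑ s, ‖c a s‖ ^ 2 :=
    Finset.sum_congr rfl fun a _ => hnorm a
  have hτ : (∑ s, ∑ a : P2', ‖∑ m : Fin 2, e s (a.1, m) (m, a.2)‖ ^ 2) = ∑ a, ∑ s, ‖τ s a‖ ^ 2 := by
    rw [Finset.sum_comm]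
  rw [hL, hN, hτ]
  exact hCS



/-- local notation for the index type of one slot -/
abbrev P2'' : Type := Fin 2 × Fin 2

theorem stub_productFrame (u v : Fin 6 → (Fin 2 × Fin 2) → ℂ) :
    ∃ (u' v' : Fin 6 → (Fin 2 × Fin 2) → ℂ) (e : Fin 6 → (Fin 2 × Fin 2) → (Fin 2 × Fin 2) → ℂ),
      (∀ s t : Fin 6, (∑ b, ∑ c, conj (e s b c) * e t b c) = if s = t then 1 else 0) ∧
      (∀ s, e s ∈ Submodule.span ℂ (Set.range fun l : Fin 6 => fun b c => u' l b * v' l c)) ∧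
      ∀ l : Fin 6, (fun b c => u l b * v l c) ∈ Submodule.span ℂ (Set.range e) := by
  classical
  -- Euclidean model of X ⊗ Y
  let L : (P2'' → P2'' → ℂ) ≃ₗ[ℂ] EuclideanSpace ℂ (P2'' × P2'') :=
    (LinearEquiv.curry ℂ ℂ P2'' P2'').symm ≪≫ₗ (WithLp.linearEquiv 2 ℂ (P2'' × P2'' → ℂ)).symm
  -- the big family of products: the six given ones and the sixteen standard ones
  let ι : Type := Fin 6 ⊕ (P2'' × P2'')
  let xf : ι → P2'' → ℂ := Sum.elim u (fun bc => Pi.single bc.1 1)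
  let yf : ι → P2'' → ℂ := Sum.elim v (fun bc => Pi.single bc.2 1)
  let pr : ι → (P2'' → P2'' → ℂ) := fun i b c => xf i b * yf i c
  let w : ι → EuclideanSpace ℂ (P2'' × P2'') := fun i => L (pr i)
  -- the standard products are the standard basis, so the whole family spans
  have hstd : ∀ bc : P2'' × P2'', w (Sum.inr bc) = EuclideanSpace.single bc (1 : ℂ) := by
    intro bc
    apply PiLp.ext
    intro p
    simp only [w, pr, xf, yf, PiLp.single_apply, Sum.elim_inr]
    show (Pi.single bc.1 (1 : ℂ) : P2'' → ℂ) p.1 * (Pi.single bc.2 (1 : ℂ) : P2'' → ℂ) p.2 = _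
    obtain ⟨b, c⟩ := bc
    obtain ⟨p1, p2⟩ := p
    by_cases h1 : p1 = b <;> by_cases h2 : p2 = c <;> simp [h1, h2, Prod.ext_iff]
  have htop : (⊤ : Submodule ℂ (EuclideanSpace ℂ (P2'' × P2''))) ≤ Submodule.span ℂ (w '' Set.univ) := by
    rw [← (EuclideanSpace.basisFun (P2'' × P2'') ℂ).toBasis.span_eq]
    refine Submodule.span_mono ?_
    rintro _ ⟨bc, rfl⟩
    refine ⟨Sum.inr bc, Set.mem_univ _, ?_⟩
    rw [hstd]
    simp
  -- step A: an independent sub-family of the six given products with the same span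
  obtain ⟨b₀, hb₀S, -, hspan₀, hli₀⟩ := exists_linearIndepOn_extension
    (linearIndepOn_empty ℂ w) (Set.empty_subset (Set.range (Sum.inl : Fin 6 → ι)))
  -- step B: extend it inside the whole family to a spanning independent family
  obtain ⟨b₁, -, hb₀b₁, hspan₁, hli₁⟩ := exists_linearIndepOn_extension hli₀ (Set.subset_univ b₀)
  -- cardinalities
  have hcard₀ : b₀.toFinset.card ≤ 6 := by
    calc b₀.toFinset.card ≤ (Set.range (Sum.inl : Fin 6 → ι)).toFinset.card :=
          Finset.card_le_card (Set.toFinset_mono hb₀S)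
      _ ≤ 6 := by
          rw [Set.toFinset_range]
          exact Finset.card_image_le.trans (by simp)
  have hcard₁ : 6 ≤ b₁.toFinset.card := by
    have htop' : Submodule.span ℂ (w '' b₁) = ⊤ :=
      eq_top_iff.mpr (htop.trans (Submodule.span_le.mpr hspan₁))
    have h1 : Module.finrank ℂ (EuclideanSpace ℂ (P2'' × P2'')) ≤ (w '' b₁).toFinset.card := by
      have := finrank_span_le_card (R := ℂ) (w '' b₁)
      rwa [htop', finrank_top] at this
    have h2 : (w '' b₁).toFinset.card ≤ b₁.toFinset.card := by
      rw [Set.toFinset_image]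
      exact Finset.card_image_le
    have h3 : Module.finrank ℂ (EuclideanSpace ℂ (P2'' × P2'')) = 16 := by
      rw [finrank_euclideanSpace]
      rfl
    omega
  -- step C: a six-element index set between b₀ and b₁
  obtain ⟨B, hb₀B, hBb₁, hB⟩ :=
    Finset.exists_subsuperset_card_eq (Set.toFinset_mono hb₀b₁) hcard₀ hcard₁
  -- step D: index it by Fin 6
  let σ : Fin 6 ≃ B := (Finset.equivFinOfCardEq hB).symm
  let pf : Fin 6 → (P2'' → P2'' → ℂ) := fun i => pr (σ i)
  let f : Fin 6 → EuclideanSpace ℂ (P2'' × P2'') := fun i => w (σ i)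
  have hBset : LinearIndepOn ℂ w (B : Set ι) := by
    refine hli₁.mono ?_
    intro i hi
    exact Set.mem_toFinset.mp (hBb₁ (Finset.mem_coe.mp hi))
  have hf : LinearIndependent ℂ f := hBset.linearIndependent.comp σ σ.injective
  -- step E: Gram–Schmidt
  let g : Fin 6 → EuclideanSpace ℂ (P2'' × P2'') := InnerProductSpace.gramSchmidtNormed ℂ f
  have hg : Orthonormal ℂ g := InnerProductSpace.gramSchmidtNormed_orthonormal hf
  have hspan_g : Submodule.span ℂ (Set.range g) = Submodule.span ℂ (Set.range f) := by
    rw [InnerProductSpace.span_gramSchmidtNormed_range, InnerProductSpace.span_gramSchmidt]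
  -- transport of spans through L
  have hLspan : ∀ (q : Fin 6 → (P2'' → P2'' → ℂ)),
      Submodule.span ℂ (Set.range fun i => L (q i)) =
        Submodule.map (L : (P2'' → P2'' → ℂ) →ₗ[ℂ] EuclideanSpace ℂ (P2'' × P2''))
          (Submodule.span ℂ (Set.range q)) := by
    intro q
    rw [Submodule.map_span, ← Set.range_comp]
    rfl
  -- the frame, read back as functions
  let e : Fin 6 → P2'' → P2'' → ℂ := fun s b c => g s (b, c)
  have hLe : ∀ s, L (e s) = g s := fun s => rfl
  refine ⟨fun i => xf (σ i), fun i => yf (σ i), e, ?_, ?_, ?_⟩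
  · -- orthonormality in coordinates
    intro s t
    have h := (orthonormal_iff_ite.mp hg) s t
    rw [PiLp.inner_apply, Fintype.sum_prod_type] at h
    rw [← h]
    refine Finset.sum_congr rfl fun b _ => Finset.sum_congr rfl fun c _ => ?_
    simp [e, mul_comm]
  · -- each frame vector lies in the span of the six products pf i = xf (σ i) ⊗ yf (σ i)
    intro s
    have hmem : g s ∈ Submodule.span ℂ (Set.range f) := hspan_g ▸ Submodule.subset_span ⟨s, rfl⟩
    have hf_eq : (fun i => L (pf i)) = f := rfl
    rw [← hf_eq, hLspan pf, ← hLe s] at hmem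
    rcases Submodule.mem_map.mp hmem with ⟨y, hy, hyL⟩
    have hye : y = e s := L.injective hyL
    rw [hye] at hy
    exact hy
  · -- each given product lies in the span of the frame
    intro l
    have h1 : w (Sum.inl l) ∈ Submodule.span ℂ (w '' b₀) := hspan₀ ⟨Sum.inl l, ⟨l, rfl⟩, rfl⟩
    have h2 : w '' b₀ ⊆ Set.range f := by
      rintro _ ⟨i, hi, rfl⟩
      have hiB : i ∈ B := hb₀B (Set.mem_toFinset.mpr hi)
      refine ⟨σ.symm ⟨i, hiB⟩, ?_⟩
      simp [f, σ]
    have h3 : w (Sum.inl l) ∈ Submodule.span ℂ (Set.range g) := by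
      rw [hspan_g]
      exact Submodule.span_mono h2 h1
    have hge : (fun i => L (e i)) = g := rfl
    rw [← hge, hLspan e] at h3
    rcases Submodule.mem_map.mp h3 with ⟨y, hy, hyL⟩
    have hyw : y = pr (Sum.inl l) := L.injective hyL
    rw [hyw] at hy
    exact hy



/-- local notation for the index type of one slot -/
abbrev P2 : Type := Fin 2 × Fin 2

theorem stub_capEasyRegime {k : ℕ} (e : Fin k → (Fin 2 × Fin 2) → (Fin 2 × Fin 2) → ℂ)
    (he : ∀ s t : Fin k, (∑ b, ∑ c, conj (e s b c) * e t b c) = if s = t then 1 else 0)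
    (hdim : Module.finrank ℂ (Submodule.span ℂ (Set.range fun s : Fin k => fun a : Fin 2 × Fin 2 =>
      ∑ μ : Fin 2, e s (a.1, μ) (μ, a.2))) ≤ 3) :
    ∑ s, ∑ a : Fin 2 × Fin 2, ‖∑ m : Fin 2, e s (a.1, m) (m, a.2)‖ ^ 2 ≤ 6 := by
  -- the four "multiplication images" μ e_s as plain functions and as Euclidean vectors
  let f : Fin k → (P2 → ℂ) := fun s a => ∑ m : Fin 2, e s (a.1, m) (m, a.2)
  let fE : Fin k → EuclideanSpace ℂ P2 := fun s => WithLp.toLp 2 (f s)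
  let L : (P2 → ℂ) ≃ₗ[ℂ] EuclideanSpace ℂ P2 := (WithLp.linearEquiv 2 ℂ (P2 → ℂ)).symm
  let V : Submodule ℂ (EuclideanSpace ℂ P2) := Submodule.span ℂ (Set.range fE)
  -- finrank V ≤ 3, transported from `hdim`
  have hVmap : V = Submodule.map (L : (P2 → ℂ) →ₗ[ℂ] EuclideanSpace ℂ P2)
      (Submodule.span ℂ (Set.range f)) := by
    rw [Submodule.map_span, ← Set.range_comp]
    rfl
  have hV : Module.finrank ℂ V ≤ 3 := by
    rw [hVmap, LinearEquiv.finrank_map_eq]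
    exact hdim
  -- the frame as Euclidean vectors on P2 × P2, orthonormal by `he`
  let eE : Fin k → EuclideanSpace ℂ (P2 × P2) := fun s => WithLp.toLp 2 (fun bc => e s bc.1 bc.2)
  have heE : Orthonormal ℂ eE := by
    rw [orthonormal_iff_ite]
    intro s t
    rw [← he s t, PiLp.inner_apply, Fintype.sum_prod_type]
    simp [eE, mul_comm]
  -- an orthonormal basis of V
  let b := stdOrthonormalBasis ℂ V
  -- the adjoint images G i = μ^*(b i)
  let G : Fin (Module.finrank ℂ V) → EuclideanSpace ℂ (P2 × P2) := fun i =>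
    WithLp.toLp 2 (fun bc => if bc.1.2 = bc.2.1 then (b i : EuclideanSpace ℂ P2) (bc.1.1, bc.2.2) else 0)
  -- (1) the left-hand side is Σ_s ‖fE s‖²
  have h1 : ∀ s, (∑ a : P2, ‖∑ m : Fin 2, e s (a.1, m) (m, a.2)‖ ^ 2) = ‖fE s‖ ^ 2 := by
    intro s
    rw [EuclideanSpace.norm_sq_eq]
  -- (2) Parseval in V
  have h2 : ∀ s, ‖fE s‖ ^ 2 = ∑ i, ‖⟪(b i : EuclideanSpace ℂ P2), fE s⟫_ℂ‖ ^ 2 := by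
    intro s
    have hs : fE s ∈ V := Submodule.subset_span ⟨s, rfl⟩
    have key := b.sum_sq_norm_inner_right ⟨fE s, hs⟩
    have hn : ‖(⟨fE s, hs⟩ : V)‖ = ‖fE s‖ := rfl
    have hi : ∀ i, ⟪b i, (⟨fE s, hs⟩ : V)⟫_ℂ = ⟪(b i : EuclideanSpace ℂ P2), fE s⟫_ℂ := fun i => rfl
    rw [hn] at key
    rw [← key]
    exact Finset.sum_congr rfl fun i _ => by rw [hi]
  -- (3) ⟪b i, fE s⟫ = ⟪G i, eE s⟫
  have h3 : ∀ i s, ⟪(b i : EuclideanSpace ℂ P2), fE s⟫_ℂ = ⟪G i, eE s⟫_ℂ := by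
    intro i s
    rw [PiLp.inner_apply, PiLp.inner_apply, Fintype.sum_prod_type, Fintype.sum_prod_type,
      Fintype.sum_prod_type]
    simp only [fE, f, G, eE, Fin.sum_univ_two, Fintype.sum_prod_type, RCLike.inner_apply, Fin.isValue]
    simp
    ring
  -- (4) Bessel for the orthonormal family eE
  have h4 : ∀ i, (∑ s, ‖⟪G i, eE s⟫_ℂ‖ ^ 2) ≤ ‖G i‖ ^ 2 := by
    intro i
    have := heE.sum_inner_products_le (G i) (s := Finset.univ)
    refine le_of_eq_of_le ?_ this
    refine Finset.sum_congr rfl fun s _ => ?_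
    rw [norm_inner_symm]
  -- (5) ‖G i‖² = 2
  have h5 : ∀ i, ‖G i‖ ^ 2 = 2 := by
    intro i
    have hb1 : ‖(b i : EuclideanSpace ℂ P2)‖ = 1 := b.orthonormal.1 i
    have hb : ‖(b i : EuclideanSpace ℂ P2)‖ ^ 2 = 1 := by rw [hb1, one_pow]
    rw [EuclideanSpace.norm_sq_eq] at hb ⊢
    rw [Fintype.sum_prod_type]
    simp only [G, Fintype.sum_prod_type, Fin.sum_univ_two, Fin.isValue] at hb ⊢
    simp
    linarith
  -- combine
  calc (∑ s, ∑ a : P2, ‖∑ m : Fin 2, e s (a.1, m) (m, a.2)‖ ^ 2)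
      = ∑ s, ∑ i, ‖⟪G i, eE s⟫_ℂ‖ ^ 2 := by
        refine Finset.sum_congr rfl fun s _ => ?_
        rw [h1, h2]
        exact Finset.sum_congr rfl fun i _ => by rw [h3]
    _ = ∑ i, ∑ s, ‖⟪G i, eE s⟫_ℂ‖ ^ 2 := Finset.sum_comm
    _ ≤ ∑ i : Fin (Module.finrank ℂ V), (2 : ℝ) :=
        Finset.sum_le_sum fun i _ => (h4 i).trans (le_of_eq (h5 i))
    _ = 2 * Module.finrank ℂ V := by simp [mul_comm]
    _ ≤ 6 := by
        have : (Module.finrank ℂ V : ℝ) ≤ 3 := by exact_mod_cast hV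
        linarith


end DrefuteProbe
end
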